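import Summits.Ventures.CertifiedManyBodySolver.Certificates.HubbardSquare_boxword_NaCCOC_M57_objE
import Summits.Ventures.CertifiedManyBodySolver.Downfold.BoxesCCOCM57
import HarnessLib

/-!
# Energy word ON the typed Na-CCOC x = 0.20 object-E box `boxCCOCE_M57` (VSET-v2 M57, Ca₁.₈Na₀.₂CuO₂Cl₂):
# hubbard-box-eng-1's whole-box word `m57_objE_word` read through the seam

Venture CertifiedManyBodySolver, cell `pub/hubbard-downfold` (stage S1 ↔ S2 seam), seat hubbard-downfold-mod-1; namespace
`Summit.Ventures.CertifiedManyBodySolver.Downfold`. `boxCCOCE_M57` (`BoxesCCOCM57.lean`: `U/t_eff ∈ [6.4, 12.9] × tp/t_eff ∈ [−0.38, −0.27]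
× n ∈ [0.78, 0.82]`, router/BOXES/CCOC-Na010.md §OF-RECORD v1.3/v1.4 rows @x0.20) is EXACTLY the cell of hubbard-box-eng-1's
`Certificates/HubbardSquare_boxword_NaCCOC_M57_objE.lean` (p505134): `m57_objE_word`, floor under the registry row `hT504` (U = 8,
t′ = −1/4 n-tangent #504), cap unconditional. The JOIN is one line:

* `boxCCOCE_M57_word_objE (hT504)` — at every member of `boxCCOCE_M57`, `−1.2002567434 ≤ e₀(1, tp/t, U/t, n) ≤ −0.6367054946` (width 0.5636 t);
* `boxCCOCE_M57_word_objE_cap` — the cap half HYPOTHESIS-FREE (`m57_cap_pol`).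

HONEST FRAMING: energy words only; the floor is CONDITIONAL on the named registry row exactly as the certificate is; the box is S1's
screening-grade interval set typed verbatim (U is a La-214 CLASS TRANSFER per the box file — transferred-U caveat of record); nothing
about order, pairing, `T_c` or a phase word. Everything is PROVED; no definition, no `sorry`.
-/

noncomputable section

namespace Summit.Ventures.CertifiedManyBodySolver.Downfold

open NonemptyInterval Literature.MathematicalPhysics.QuantumLattice
  Literature.MathematicalPhysics.QuantumLattice.ThermodynamicLimit
  Summit.Ventures.CertifiedManyBodySolver.Certificates
  Summit.Ventures.CertifiedManyBodySolver.Certificates.BoxWordSliver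

/-- **Word on `boxCCOCE_M57`** (Na-CCOC x = 0.20 object E): at every member, `−1.2002567434 ≤ e₀ ≤ −0.6367054946`
(`m57_objE_word` through `boxCCOCE_M57_energyWord`; floor under `hT504`). [cite: Israel1979, Thm. I.3.4] [cite: LiebLoss1993, §8, Theorem 8.2] -/
theorem boxCCOCE_M57_word_objE
    (hT504 : ∀ m : ℝ, 0 ≤ m → m < 2 → (-1008420703687177600106633/1208925819614629174706176 : ℝ) +
      (819507284335/549755813888 : ℝ) * (m - 7/8) ≤ energyDensityTT' 1 (-1/4) 8 m) :
    HoldsOn (fun p : OneBandCoord → ℝ =>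
      (-1.2002567434 : ℝ) ≤ energyDensityTT' 1 (p .tpOverT) (p .UOverT) (p .filling) ∧
        energyDensityTT' 1 (p .tpOverT) (p .UOverT) (p .filling) ≤ (-0.6367054946 : ℝ)) boxCCOCE_M57 :=
  boxCCOCE_M57_energyWord (m57_objE_word hT504)

/-- **Hypothesis-free CAP on `boxCCOCE_M57`**: at every member, `e₀ ≤ −0.6367054946` (box-eng-1's unconditional polarized-row cap
`m57_cap_pol`). [cite: LiebLoss1993, §8, Theorem 8.2] -/
theorem boxCCOCE_M57_word_objE_cap :
    HoldsOn (fun p : OneBandCoord → ℝ =>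
      energyDensityTT' 1 (p .tpOverT) (p .UOverT) (p .filling) ≤ (-0.6367054946 : ℝ)) boxCCOCE_M57 := by
  have h := holdsOn_of_forall_s2Box (B := boxCCOCE_M57) (eU := cCOCE_M57_U) (eS := cCOCE_M57_tp) (eN := cCOCE_M57_n)
    rfl rfl rfl (W := fun θ => energyDensityTT' 1 (θ 1) (θ 0) (θ 2) ≤ (-0.6367054946 : ℝ))
    (by rw [cCOCE_M57_s2Lo, cCOCE_M57_s2Hi]; exact fun θ hθ => m57_cap_pol θ hθ)
  exact h

end Summit.Ventures.CertifiedManyBodySolver.Downfold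

end
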